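import Literature.NumberTheory.Transcendental.AyoubPeriodSeriesPiAlgebraic
import Mathlib.Algebra.Polynomial.Derivative
import Mathlib.RingTheory.HahnSeries.PowerSeries
import HarnessLib

/-!
# Elements of `𝒪†_{k-alg}(𝔻̄^∞)` involve finitely many variables, uniformly in the `ϖ`-degree

Proofs only, on top of `Literature/NumberTheory/Transcendental/AyoubPeriodSeries.lean` and its
proof files.  Source: J. Ayoub, *La version relative de la conjecture des périodes de
Kontsevich–Zagier revisitée* (`AyoubRelKZRevisited`), §1.1, p. 2: "Ainsi, un élément
`F ∈ 𝒪†_{k-alg}(𝔻̄^∞)` est une série de Laurent `F = Σ_r f_r ϖ^r` à coefficients dans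
`𝒪_{k-alg}(𝔻̄^∞)` et la condition d'algébricité entraîne en particulier que les coefficients `f_r`
ne dépendent que d'un nombre fini des `z_i` indépendemment de `r`."

## What is proved

* `exists_dependsOnlyOnLT_of_mem_OanDagger` (**the sentence above**): for `char k = 0`, every
  `F ∈ 𝒪†_{k-alg}(𝔻̄^∞)` (indeed every `F ∈ ℂ[[z]]((ϖ))` algebraic over `k[z][ϖ]`,
  `exists_eulerL_eq_zero_of_isAlgebraicLaurent`) has all its `ϖ`-coefficients in
  `ℂ[[z_0, …, z_{M-1}]]` for one `M`.
* `exists_bound_usesVarL_of_mem_OanDagger`: hence the set of variables involved in `F` is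
  bounded, so fresh variables (disjoint from those of `F`) always exist — the side condition
  "`g` in variables disjoint from those of `F`" in the Lean rendering
  `ayoub_integration_injective_localized` of Théorème 1.11 is never an obstruction (combine with
  `exists_mem_Oan_intC_eq_two_pi_I_pow` of `AyoubPeriodSeriesLocalizing.lean`, which produces
  `g ∈ 𝒪_{k-alg}(𝔻̄^∞)` avoiding any finite set of variables with `∫ g = (2πi)^N`).

## The argument (derivations; not spelled out in the note)

Let `E_J = z_J ∂/∂z_J` be the Euler operator in the variable `z_J` on `ℂ[[z]]`
(`coeff_a (E_J F) = a_J · coeff_a F`), extended coefficientwise to a derivation `D_J` of the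
domain `ℂ[[z]]((ϖ))` (`eulerL`, `eulerL_mul`, `eulerL_pow`).  If `P(F) = 0` with `0 ≠ P ∈ k[z][ϖ][Y]` of minimal degree
and `J` exceeds every variable index occurring in `P`, then `D_J` kills the coefficients of `P`,
so `0 = D_J(P(F)) = P'(F) · D_J F` with `P'(F) ≠ 0` (minimality; `P' ≠ 0` in characteristic `0`),
whence `D_J F = 0`, i.e. no `ϖ`-coefficient of `F` involves `z_J`.
-/

noncomputable section

open Finsupp MvPowerSeries

namespace Literature.NumberTheory.Transcendental.AyoubRel

/-! ### The Euler operator `z_J ∂/∂z_J` on `ℂ[[z]]` -/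

/-- **Euler operator** `E_J F = z_J ∂F/∂z_J` on `ℂ[[z]]`: `coeff_a (E_J F) = a_J · coeff_a F`
(a `ℂ`-linear map). [folklore] -/
def eulerZ (J : ℕ) : CSeries →ₗ[ℂ] CSeries where
  toFun F := fun a => (a J : ℂ) * coeff a F
  map_add' F G := by
    ext a
    rw [map_add]
    change (a J : ℂ) * coeff a (F + G) = (a J : ℂ) * coeff a F + (a J : ℂ) * coeff a G
    rw [map_add, mul_add]
  map_smul' c F := by
    ext a
    rw [coeff_smul]
    change (a J : ℂ) * coeff a (c • F) = c * ((a J : ℂ) * coeff a F)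
    rw [coeff_smul]
    ring

/-- Coefficients of `E_J F`. [folklore] -/
@[simp] theorem coeff_eulerZ (J : ℕ) (F : CSeries) (a : ℕ →₀ ℕ) :
    coeff a (eulerZ J F) = (a J : ℂ) * coeff a F := rfl

/-- **Leibniz rule** `E_J (F G) = E_J F · G + F · E_J G` (termwise: `a_J = b_J + c_J` on the
antidiagonal `b + c = a`). [folklore] -/
theorem eulerZ_mul (J : ℕ) (F G : CSeries) :
    eulerZ J (F * G) = eulerZ J F * G + F * eulerZ J G := by
  ext a
  rw [coeff_eulerZ, map_add, coeff_mul, coeff_mul, coeff_mul, Finset.mul_sum,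
    ← Finset.sum_add_distrib]
  refine Finset.sum_congr rfl fun p hp => ?_
  rw [Finset.HasAntidiagonal.mem_antidiagonal] at hp
  rw [coeff_eulerZ, coeff_eulerZ]
  have h : (a J : ℂ) = (p.1 J : ℂ) + (p.2 J : ℂ) := by
    rw [← hp, Finsupp.add_apply, Nat.cast_add]
  rw [h]
  ring

/-- `E_J 1 = 0`. [folklore] -/
theorem eulerZ_one (J : ℕ) : eulerZ J (1 : CSeries) = 0 := by
  ext a
  rw [coeff_eulerZ, map_zero, coeff_one]
  split_ifs with h
  · rw [h]
    simp
  · rw [mul_zero]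

/-- `E_J F = 0` iff `F` does not involve `z_J` (characteristic `0` of `ℂ`). [folklore] -/
theorem eulerZ_eq_zero_iff (J : ℕ) (F : CSeries) : eulerZ J F = 0 ↔ ¬ UsesVar F J := by
  constructor
  · rintro h ⟨a, haJ, hne⟩
    have h' := congrArg (coeff a) h
    rw [coeff_eulerZ, map_zero, mul_eq_zero] at h'
    rcases h' with h0 | h0
    · exact haJ (by exact_mod_cast h0)
    · exact hne h0
  · intro h
    ext a
    rw [coeff_eulerZ, map_zero]
    by_cases haJ : a J = 0
    · rw [haJ, Nat.cast_zero, zero_mul]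
    · have h0 : coeff a F = 0 := by
        by_contra hne
        exact h ⟨a, haJ, hne⟩
      rw [h0, mul_zero]

/-- `E_J` kills a polynomial none of whose monomials involves `z_J`. [folklore] -/
theorem eulerZ_coe_eq_zero (J : ℕ) (q : MvPolynomial ℕ ℂ) (hq : ∀ d ∈ q.support, d J = 0) :
    eulerZ J (q : CSeries) = 0 := by
  ext a
  rw [coeff_eulerZ, map_zero, MvPolynomial.coeff_coe]
  by_cases ha : a ∈ q.support
  · rw [hq a ha, Nat.cast_zero, zero_mul]
  · rw [MvPolynomial.notMem_support_iff.mp ha, mul_zero]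

/-! ### The coefficientwise Euler derivation `D_J` of `ℂ[[z]]((ϖ))` -/

/-- `D_J`: the Euler operator `E_J` applied to every `ϖ`-coefficient of a Laurent series.
[folklore] -/
def eulerL (J : ℕ) (F : LaurentSeries CSeries) : LaurentSeries CSeries := F.map (eulerZ J)

/-- Coefficients of `D_J F`. [folklore] -/
@[simp] theorem coeff_eulerL (J : ℕ) (F : LaurentSeries CSeries) (r : ℤ) :
    (eulerL J F).coeff r = eulerZ J (F.coeff r) := rfl

/-- `supp (D_J F) ⊆ supp F`. [folklore] -/
theorem support_eulerL_subset (J : ℕ) (F : LaurentSeries CSeries) :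
    (eulerL J F).support ⊆ F.support := by
  intro r hr
  rw [HahnSeries.mem_support] at hr ⊢
  intro h0
  apply hr
  rw [coeff_eulerL, h0, map_zero]

/-- `D_J` is additive. [folklore] -/
theorem eulerL_add (J : ℕ) (F G : LaurentSeries CSeries) :
    eulerL J (F + G) = eulerL J F + eulerL J G := by
  apply HahnSeries.ext
  funext r
  rw [coeff_eulerL, HahnSeries.coeff_add, HahnSeries.coeff_add, map_add, coeff_eulerL, coeff_eulerL]

/-- `D_J` is `ℂ`-linear. [folklore] -/
theorem eulerL_smul (J : ℕ) (c : ℂ) (F : LaurentSeries CSeries) :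
    eulerL J (c • F) = c • eulerL J F := by
  apply HahnSeries.ext
  funext r
  rw [coeff_eulerL, HahnSeries.coeff_smul, HahnSeries.coeff_smul, map_smul, coeff_eulerL]

/-- **Leibniz rule for `D_J`** on `ℂ[[z]]((ϖ))` (Cauchy product over the additive antidiagonal,
termwise Leibniz for `E_J`). [folklore] -/
theorem eulerL_mul (J : ℕ) (F G : LaurentSeries CSeries) :
    eulerL J (F * G) = eulerL J F * G + F * eulerL J G := by
  apply HahnSeries.ext
  funext r
  rw [HahnSeries.coeff_add, coeff_eulerL, HahnSeries.coeff_mul, map_sum,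
    HahnSeries.coeff_mul_left' F.isPWO_support (support_eulerL_subset J F),
    HahnSeries.coeff_mul_right' G.isPWO_support (support_eulerL_subset J G),
    ← Finset.sum_add_distrib]
  refine Finset.sum_congr rfl fun p _ => ?_
  rw [coeff_eulerL, coeff_eulerL, eulerZ_mul]

/-- `D_J 1 = 0`. [folklore] -/
theorem eulerL_one (J : ℕ) : eulerL J (1 : LaurentSeries CSeries) = 0 := by
  apply HahnSeries.ext
  funext r
  rw [coeff_eulerL, HahnSeries.coeff_one, HahnSeries.coeff_zero]
  split_ifs
  · exact eulerZ_one J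
  · exact map_zero _

/-- `D_J` as an additive monoid homomorphism (for `map_sum`). [folklore] -/
def eulerLHom (J : ℕ) : LaurentSeries CSeries →+ LaurentSeries CSeries where
  toFun := eulerL J
  map_zero' := by
    apply HahnSeries.ext
    funext r
    rw [coeff_eulerL, HahnSeries.coeff_zero, map_zero]
  map_add' := eulerL_add J

/-- `eulerLHom J` is `D_J`. [folklore] -/
@[simp] theorem eulerLHom_apply (J : ℕ) (F : LaurentSeries CSeries) : eulerLHom J F = eulerL J F :=
  rfl

/-- **Power rule** `D_J (x^n) = n x^{n-1} D_J x`. [folklore] -/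
theorem eulerL_pow (J : ℕ) (x : LaurentSeries CSeries) (n : ℕ) :
    eulerL J (x ^ n) = (n : LaurentSeries CSeries) * x ^ (n - 1) * eulerL J x := by
  induction n with
  | zero => rw [pow_zero, eulerL_one, Nat.cast_zero, zero_mul, zero_mul]
  | succ n ih =>
    rw [pow_succ, eulerL_mul, ih, Nat.add_sub_cancel, Nat.cast_succ]
    rcases n with _ | n
    · simp
    · rw [Nat.add_sub_cancel, pow_succ]
      ring

/-- `D_J (x ϖ^r) = (E_J x) ϖ^r`. [folklore] -/
theorem eulerL_single (J : ℕ) (r : ℤ) (x : CSeries) :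
    eulerL J (HahnSeries.single r x) = HahnSeries.single r (eulerZ J x) := by
  apply HahnSeries.ext
  funext n
  rw [coeff_eulerL]
  by_cases h : n = r
  · subst h
    rw [HahnSeries.coeff_single_same, HahnSeries.coeff_single_same]
  · rw [HahnSeries.coeff_single_of_ne h, HahnSeries.coeff_single_of_ne h, map_zero]

/-- **`D_J(P(x)) = P'(x) · D_J x` when `D_J` kills the coefficients of `P`.** [folklore] -/
theorem eulerL_eval₂_of_coeff (J : ℕ) {A : Type*} [CommSemiring A]
    (φ : A →+* LaurentSeries CSeries) (P : Polynomial A)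
    (hP : ∀ n, eulerL J (φ (P.coeff n)) = 0) (x : LaurentSeries CSeries) :
    eulerL J (P.eval₂ φ x) = (Polynomial.derivative P).eval₂ φ x * eulerL J x := by
  have hder : (Polynomial.derivative P).eval₂ φ x =
      ∑ n ∈ P.support, φ (P.coeff n) * (n : LaurentSeries CSeries) * x ^ (n - 1) := by
    rw [Polynomial.derivative_apply, Polynomial.eval₂_sum, Polynomial.sum_def]
    refine Finset.sum_congr rfl fun n _ => ?_
    rw [Polynomial.eval₂_mul, Polynomial.eval₂_C, Polynomial.eval₂_X_pow, map_mul, map_natCast]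
  rw [Polynomial.eval₂_eq_sum, Polynomial.sum_def, ← eulerLHom_apply, map_sum, hder, Finset.sum_mul]
  refine Finset.sum_congr rfl fun n _ => ?_
  rw [eulerLHom_apply, eulerL_mul, eulerL_pow, hP n, zero_mul, zero_add]
  ring

section Variables

variable {k : Type} [Field k] (σ : k →+* ℂ)

/-- `k[z] → ℂ[[z]]` along `σ` is injective. [folklore] -/
theorem polyToCSeries_injective : Function.Injective (polyToCSeries σ) := fun _ _ h =>
  MvPolynomial.map_injective σ σ.injective (MvPolynomial.coe_injective ℕ ℂ h)

/-- `k[z][ϖ] → ℂ[[z]]((ϖ))` factors as `map (k[z] → ℂ[[z]])`, then `ℂ[[z]][ϖ] ⊂ ℂ[[z]][[ϖ]] ⊂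
ℂ[[z]]((ϖ))`. [folklore] -/
theorem polyToCLaurent_eq_comp :
    polyToCLaurent σ = ((HahnSeries.ofPowerSeries ℤ CSeries).comp
      (Polynomial.coeToPowerSeries.ringHom : Polynomial CSeries →+* PowerSeries CSeries)).comp
      (Polynomial.mapRingHom (polyToCSeries σ)) := by
  refine Polynomial.ringHom_ext (fun a => ?_) ?_
  · rw [polyToCLaurent_C, RingHom.comp_apply, RingHom.comp_apply, Polynomial.coe_mapRingHom,
      Polynomial.map_C, Polynomial.coeToPowerSeries.ringHom_apply, Polynomial.coe_C,
      HahnSeries.ofPowerSeries_C]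
  · rw [polyToCLaurent_X, RingHom.comp_apply, RingHom.comp_apply, Polynomial.coe_mapRingHom,
      Polynomial.map_X, Polynomial.coeToPowerSeries.ringHom_apply, Polynomial.coe_X,
      HahnSeries.ofPowerSeries_X]

/-- `k[z][ϖ] → ℂ[[z]]((ϖ))` along `σ` is injective. [folklore] -/
theorem polyToCLaurent_injective : Function.Injective (polyToCLaurent σ) := by
  rw [polyToCLaurent_eq_comp]
  exact (HahnSeries.ofPowerSeries_injective.comp (Polynomial.coe_injective CSeries)).comp
    (Polynomial.map_injective _ (polyToCSeries_injective σ))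

/-- `E_J` kills the image of a polynomial of `k[z]` not involving `z_J`. [folklore] -/
theorem eulerZ_polyToCSeries_eq_zero (J : ℕ) {q : MvPolynomial ℕ k} (hq : ∀ d ∈ q.support, d J = 0) :
    eulerZ J (polyToCSeries σ q) = 0 := by
  change eulerZ J ((MvPolynomial.map σ q : MvPolynomial ℕ ℂ) : CSeries) = 0
  exact eulerZ_coe_eq_zero J _ fun d hd => hq d (MvPolynomial.support_map_subset _ _ hd)

/-- `D_J` kills the image of an element of `k[z][ϖ]` not involving `z_J`. [folklore] -/
theorem eulerL_polyToCLaurent_eq_zero (J : ℕ) {c : Polynomial (MvPolynomial ℕ k)}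
    (hc : ∀ i, ∀ d ∈ (c.coeff i).support, d J = 0) :
    eulerL J (polyToCLaurent σ c) = 0 := by
  conv_lhs => rw [c.as_sum_support_C_mul_X_pow]
  rw [map_sum, ← eulerLHom_apply, map_sum]
  refine Finset.sum_eq_zero fun i _ => ?_
  have h1 : eulerL J (HahnSeries.C (polyToCSeries σ (c.coeff i))) = 0 := by
    rw [HahnSeries.C_apply, eulerL_single, eulerZ_polyToCSeries_eq_zero σ J (hc i),
      HahnSeries.single_eq_zero]
  have h2 : eulerL J (HahnSeries.single (1 : ℤ) (1 : CSeries)) = 0 := by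
    rw [eulerL_single, eulerZ_one, HahnSeries.single_eq_zero]
  rw [eulerLHom_apply, map_mul, map_pow, eulerL_mul, eulerL_pow, polyToCLaurent_C,
    polyToCLaurent_X, h1, h2]
  simp only [zero_mul, mul_zero, add_zero]

/-- **Algebraic Laurent series are killed by `D_J` for all large `J`.**  If `F ∈ ℂ[[z]]((ϖ))` is
algebraic over `k[z][ϖ]` (`char k = 0`), there is `M` with `D_J F = 0` for all `J ≥ M`
(minimal polynomial `P`: `0 = D_J(P(F)) = P'(F) · D_J F`, `P'(F) ≠ 0`, and `ℂ[[z]]((ϖ))` is a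
domain). [cite: AyoubRelKZRevisited, §1.1] -/
theorem exists_eulerL_eq_zero_of_isAlgebraicLaurent [CharZero k] {F : LaurentSeries CSeries}
    (hF : IsAlgebraicLaurentOverRatFunc σ F) : ∃ M : ℕ, ∀ J, M ≤ J → eulerL J F = 0 := by
  classical
  have hex : ∃ n, ∃ P : Polynomial (Polynomial (MvPolynomial ℕ k)), P ≠ 0 ∧ P.natDegree = n ∧
      Polynomial.eval₂ (polyToCLaurent σ) F P = 0 := by
    obtain ⟨P, hP, h0⟩ := hF
    exact ⟨_, P, hP, rfl, h0⟩
  obtain ⟨P, hP0, hdeg, hPF⟩ := Nat.find_spec hex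
  have hmin : ∀ Q : Polynomial (Polynomial (MvPolynomial ℕ k)), Q ≠ 0 →
      Q.natDegree < P.natDegree → Polynomial.eval₂ (polyToCLaurent σ) F Q ≠ 0 := by
    intro Q hQ hlt h0
    rw [hdeg] at hlt
    exact Nat.find_min hex hlt ⟨Q, hQ, rfl, h0⟩
  -- the finite set of variable indices occurring in `P`
  set V : Finset ℕ := P.support.biUnion fun n => (P.coeff n).support.biUnion fun i =>
    ((P.coeff n).coeff i).support.biUnion fun d => d.support with hV
  refine ⟨V.sup id + 1, fun J hJ => ?_⟩
  have hJV : J ∉ V := fun h => by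
    have h' : id J ≤ V.sup id := Finset.le_sup h
    rw [id_eq] at h'
    omega
  have hvars : ∀ n i, ∀ d ∈ ((P.coeff n).coeff i).support, d J = 0 := by
    intro n i d hd
    by_contra hdJ
    apply hJV
    rw [hV, Finset.mem_biUnion]
    refine ⟨n, ?_, Finset.mem_biUnion.mpr ⟨i, ?_, Finset.mem_biUnion.mpr
      ⟨d, hd, Finsupp.mem_support_iff.mpr hdJ⟩⟩⟩
    · rw [Polynomial.mem_support_iff]
      intro h0
      rw [h0, Polynomial.coeff_zero, MvPolynomial.support_zero] at hd
      simp at hd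
    · rw [Polynomial.mem_support_iff]
      intro h0
      rw [h0, MvPolynomial.support_zero] at hd
      simp at hd
  have hcoef : ∀ n, eulerL J (polyToCLaurent σ (P.coeff n)) = 0 := fun n =>
    eulerL_polyToCLaurent_eq_zero σ J (hvars n)
  have hd0 : P.natDegree ≠ 0 := by
    intro h
    have hPc := Polynomial.eq_C_of_natDegree_eq_zero h
    rw [hPc, Polynomial.eval₂_C] at hPF
    have h0 : P.coeff 0 = 0 := polyToCLaurent_injective σ (by rw [hPF, map_zero])
    apply hP0
    rw [hPc, h0, map_zero]
  have hD : Polynomial.derivative P ≠ 0 := Polynomial.derivative_ne_zero.mpr hd0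
  have hne : Polynomial.eval₂ (polyToCLaurent σ) F (Polynomial.derivative P) ≠ 0 :=
    hmin _ hD (Polynomial.natDegree_derivative_lt hd0)
  have key := eulerL_eval₂_of_coeff J (polyToCLaurent σ) P hcoef F
  rw [hPF, ← eulerLHom_apply, map_zero] at key
  exact (mul_eq_zero.mp key.symm).resolve_left hne

/-- **Ayoub, §1.1: the `ϖ`-coefficients of an element of `𝒪†_{k-alg}(𝔻̄^∞)` involve finitely many
variables `z_i`, uniformly in the `ϖ`-degree** ("la condition d'algébricité entraîne en
particulier que les coefficients `f_r` ne dépendent que d'un nombre fini des `z_i` indépendemment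
de `r`"; `char k = 0`). [cite: AyoubRelKZRevisited, §1.1] -/
theorem exists_dependsOnlyOnLT_of_mem_OanDagger [CharZero k] {F : LaurentSeries CSeries}
    (hF : F ∈ OanDagger σ) : ∃ M : ℕ, ∀ r : ℤ, DependsOnlyOnLT (F.coeff r) M := by
  obtain ⟨M, hM⟩ := exists_eulerL_eq_zero_of_isAlgebraicLaurent σ hF.2
  refine ⟨M, fun r a ha => ?_⟩
  obtain ⟨i, hi, hai⟩ := ha
  have h := congrArg (fun G : LaurentSeries CSeries => G.coeff r) (hM i hi)
  simp only [coeff_eulerL, HahnSeries.coeff_zero] at h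
  have h' := (eulerZ_eq_zero_iff i (F.coeff r)).mp h
  by_contra hne
  exact h' ⟨a, hai, hne⟩

/-- The variables of `F ∈ 𝒪†_{k-alg}(𝔻̄^∞)` are bounded. [cite: AyoubRelKZRevisited, §1.1] -/
theorem exists_bound_usesVarL_of_mem_OanDagger [CharZero k] {F : LaurentSeries CSeries}
    (hF : F ∈ OanDagger σ) : ∃ M : ℕ, ∀ i, UsesVarL F i → i < M := by
  obtain ⟨M, hM⟩ := exists_dependsOnlyOnLT_of_mem_OanDagger σ hF
  refine ⟨M, fun i ⟨r, a, hai, hne⟩ => ?_⟩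
  by_contra hi
  exact hne (hM r a ⟨i, not_lt.mp hi, hai⟩)

end Variables

end Literature.NumberTheory.Transcendental.AyoubRel
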